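import Summits.BirchSwinnertonDyer.Rank1Residual.Additive.RamifiedSevenGenusMemberGrossencharacter
import Literature.NumberTheory.EllipticCurves.DeuringGrossencharacterWithGeneratorsHolds
import HarnessLib

/-!
# `𝒞₇` genus road (crux `EllipticUnitValueSevenOfGZK`, K7r), row K2C-9 item (C3′): the member-level Grössencharacter
# export WITH Deuring's clause (vi) (generator values) — sibling of `exists_deuringCharacter_member`

Cell `bsd-cm`, seat `bsd-cm-prr-ty1` g35 (literature-prover); pen D1039 (2) / D1041: «`exists_deuringCharacter_member`
(`RamifiedSevenGenusMemberGrossencharacter.lean` l.107) drops Deuring's clause (vi) and (C3) exports only the three ψ-pins, so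
the F-D discharge of (psiK) (stated for ANY ψ carrying (vi)) meets «the intended ψ» only through a NEW export: (C3′)
member-level ψ-export WITH clause (vi) — Additive sibling of (C3), S-sized, 0 facts
(`Deuring_exists_heckeCharacter_of_maximalCM_withGenerators_holds` is PROVED)».

## Contents

* ★ `exists_deuringCharacter_member_withGenerators` — for `W/ℚ` elliptic with `cmFieldDiscrOfJ W.j = −7`, a quadratic
  `Kcm ∋ s`, `s² = −7`, and `c ≠ 1`: a globally minimal `W₂ ~ W` with `j(W₂) = −3375` and `ψ : HeckeCharacter Kcm` with ALL
  SIX clauses of the tree THEOREM `Deuring_exists_heckeCharacter_of_maximalCM_withGenerators_holds` at `W₂` — (i) type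
  `(1,0)`, (ii) `c`-equivariance, (iii) `ψ` unramified ⇔ good reduction of `W₂/Kcm`, (iv) the Frobenius values above the good
  rational primes (kept this time), (v) `L(ψ, s) = L(W₂, s)`, (vi) ONE `σ : Kcm →+* ℂ` with `ψ(ϖ_w) = σ(α_w)`, `(α_w) = w`
  at every `ψ`-unramified `w` — plus `L(ψ, s) = L(W, s)` by isogeny invariance (as in (C3)).
* `exists_grossencharacter_withGenerators` — the hypothesis-free form in the `PinnedKatoGenusFrame` currency (`ψ`,
  `ψ_infinityType`, `ψ_LSeries`) together with (iii) and (vi): exactly what F-D2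
  (`PinnedKatoGenusFrame.exists_psiCoords_of_generators`, `KatoExpDatum.ofLawsOfGenerators`) consumes as `hvi`, the
  reduction clause (iii) being what the frame constructor (K2C-16) turns into the ramification support (ram).
* `exists_grossencharacter_withGenerators_of_classCSeven` — the same on the class `𝒞₇`.

HONEST LABEL: a re-export of a PROVED Literature theorem at the member (no `def`, no instance, no new fact, D-0026); it
constructs no frame; stmt-BirchSwinnertonDyer-19945 OPEN; `X12.CMRamifiedSeven` NOT proved; no summit statement is proved by
this seat; BSD is claimed for no curve.

## References

[cite: SilvermanATAEC1994, Ch. II Thm. 9.1 (i) (p. 162), Thm. 9.2 (pp. 164–165), Prop. 10.4 with proof and Cor. 10.4.1 (a) (pp. 170–171), Thm. 10.5 (b) (pp. 171–172)]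
[cite: Gross1980, §8.2 (8.2.2)–(8.2.6)] [cite: Faltings1983Endlichkeit, §5 Korollar 2 (isogenous curves have equal L-series)]
-/

set_option autoImplicit false

noncomputable section

open scoped Classical

open scoped NumberField

open WeierstrassCurve NumberField IsDedekindDomain Literature.NumberTheory.GaloisRepresentations
  Literature.NumberTheory.EllipticCurves Literature.NumberTheory.EllipticCurves.Rank1Residual

namespace Summit.BirchSwinnertonDyer.Rank1Residual.Additive.GenusSeven.MemberGrossencharacter

/-- ★ **DEURING AT THE MEMBER, WITH GENERATOR VALUES (clause (vi))**: for `W/ℚ` elliptic with `d_K = −7` and any quadratic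
`Kcm ∋ √−7` with a non-trivial automorphism `c`, there are a globally minimal `W₂ ~ W` with `j(W₂) = −3375` and a Hecke
character `ψ` of `Kcm` of type `(1,0)`, `c`-equivariant, unramified exactly where `W₂/Kcm` has good reduction, with the
Frobenius values above the good rational primes, `L(ψ, s) = L(W₂, s) = L(W, s)` on `re s > 3/2`, AND one embedding
`σ : Kcm → ℂ` such that at every `ψ`-unramified `w` the value `ψ(ϖ_w)` is `σ(α_w)` for a generator `α_w` of `w` — the tree's
THEOREM `Deuring_exists_heckeCharacter_of_maximalCM_withGenerators_holds` at `W₂`, and isogeny invariance of `L`.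
[cite: SilvermanATAEC1994, Ch. II Thm. 9.2 (pp. 164–165), Prop. 10.4 with proof and Cor. 10.4.1 (a) (pp. 170–171), Thm. 10.5 (b) (pp. 171–172)]
[cite: Faltings1983Endlichkeit, §5 Korollar 2] -/
theorem exists_deuringCharacter_member_withGenerators {W : WeierstrassCurve ℚ} [W.IsElliptic]
    (hj : cmFieldDiscrOfJ W.j = -7)
    (Kcm : Type) [Field Kcm] [NumberField Kcm] (h2 : Module.finrank ℚ Kcm = 2) (s : Kcm) (hs : s ^ 2 = -7)
    (c : Kcm ≃ₐ[ℚ] Kcm) (hc : c ≠ 1) :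
    ∃ (W₂ : WeierstrassCurve ℚ) (_ : W₂.IsElliptic) (_ : W₂.IsGloballyMinimal) (ψ : HeckeCharacter Kcm),
      IsIsogenous W W₂ ∧ W₂.j = -3375 ∧
      ψ.HasInfinityType (fun _ ↦ 1) (fun _ ↦ 0) ∧ IsHeckeConjEquivariant c ψ ∧
      (∀ w : HeightOneSpectrum (𝓞 Kcm),
        ψ.IsUnramifiedAt w ↔ (W₂.baseChange Kcm).HasGoodReductionAt w) ∧
      (∀ (p : ℕ) [Fact p.Prime], W₂.HasGoodReductionAtPrime p →
        ∀ w : HeightOneSpectrum (𝓞 Kcm), (p : 𝓞 Kcm) ∈ w.asIdeal →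
          ψ.IsUnramifiedAt w ∧
          (c • w ≠ w →
            ψ.valueAtUniformizer w + ψ.valueAtUniformizer (c • w) = (W₂.frobeniusTrace p : ℂ) ∧
            ψ.valueAtUniformizer w * ψ.valueAtUniformizer (c • w) = (p : ℂ)) ∧
          (c • w = w → W₂.frobeniusTrace p = 0 ∧ ψ.valueAtUniformizer w = -(p : ℂ))) ∧
      (∀ z : ℂ, 3 / 2 < z.re → heckeLFunction ψ z = W₂.LSeries z) ∧
      (∀ z : ℂ, 3 / 2 < z.re → heckeLFunction ψ z = W.LSeries z) ∧
      ∃ σ : Kcm →+* ℂ, ∀ w : HeightOneSpectrum (𝓞 Kcm), ψ.IsUnramifiedAt w →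
        ∃ α : 𝓞 Kcm, Ideal.span {α} = w.asIdeal ∧ ψ.valueAtUniformizer w = σ α := by
  obtain ⟨W₂, hW₂, hmin, hiso, hjW₂⟩ := exists_isIsogenous_isGloballyMinimal_j_eq hj
  haveI := hW₂
  haveI := hmin
  have hmem : W₂.j ∈ maximalCMJInvariants := by
    rw [hjW₂]
    simp [maximalCMJInvariants]
  have hK : IsCMFieldOfJ Kcm W₂.j := by
    rw [hjW₂]
    exact isCMFieldOfJ_neg3375 Kcm h2 s hs
  obtain ⟨ψ, htype, hconj, hunr, hfrob, hL, hgen⟩ :=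
    Deuring_exists_heckeCharacter_of_maximalCM_withGenerators_holds W₂ hmem Kcm hK c hc
  have hLW : W₂.LSeries = W.LSeries := (IsIsogenous.LSeries_eq hiso).symm
  exact ⟨W₂, hW₂, hmin, ψ, hiso, hjW₂, htype, hconj, hunr, hfrob, hL, fun z hz ↦ by rw [hL z hz, hLW], hgen⟩

/-- **THE (λ1) GRÖSSENCHARACTER COLUMN WITH CLAUSES (iii) AND (vi), hypothesis-free**: for `W/ℚ` elliptic with
`cmFieldDiscrOfJ W.j = −7` and any quadratic `Kcm ∋ √−7` there are a globally minimal `W₂ ~ W` with `j(W₂) = −3375` and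
`ψ : HeckeCharacter Kcm` with the `PinnedKatoGenusFrame` pins `ψ_infinityType`, `ψ_LSeries` token for token, the reduction
clause (iii) at `W₂`, and Deuring's clause (vi) — the `hvi` input of `KatoExpDatum.ofLawsOfGenerators` (F-D2) VERBATIM.
[cite: SilvermanATAEC1994, Ch. II Thm. 9.2, Prop. 10.4 (proof) and Cor. 10.4.1 (a), Thm. 10.5 (b)] [cite: Faltings1983Endlichkeit, §5 Korollar 2] -/
theorem exists_grossencharacter_withGenerators {W : WeierstrassCurve ℚ} [W.IsElliptic] (hj : cmFieldDiscrOfJ W.j = -7)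
    (Kcm : Type) [Field Kcm] [NumberField Kcm] (h2 : Module.finrank ℚ Kcm = 2) (s : Kcm) (hs : s ^ 2 = -7) :
    ∃ (W₂ : WeierstrassCurve ℚ) (_ : W₂.IsElliptic) (_ : W₂.IsGloballyMinimal) (ψ : HeckeCharacter Kcm),
      IsIsogenous W W₂ ∧ W₂.j = -3375 ∧
      ψ.HasInfinityType (fun _ ↦ 1) (fun _ ↦ 0) ∧
      (∀ z : ℂ, 3 / 2 < z.re → heckeLFunction ψ z = W.LSeries z) ∧
      (∀ w : HeightOneSpectrum (𝓞 Kcm),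
        ψ.IsUnramifiedAt w ↔ (W₂.baseChange Kcm).HasGoodReductionAt w) ∧
      ∃ σ : Kcm →+* ℂ, ∀ w : HeightOneSpectrum (𝓞 Kcm), ψ.IsUnramifiedAt w →
        ∃ α : 𝓞 Kcm, Ideal.span {α} = w.asIdeal ∧ ψ.valueAtUniformizer w = σ α := by
  obtain ⟨c, hc⟩ := exists_algEquiv_ne_one Kcm h2
  obtain ⟨W₂, hW₂, hmin, ψ, hiso, hjW₂, htype, -, hunr, -, -, hL, hgen⟩ :=
    exists_deuringCharacter_member_withGenerators hj Kcm h2 s hs c hc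
  exact ⟨W₂, hW₂, hmin, ψ, hiso, hjW₂, htype, hL, hunr, hgen⟩

/-- **The (λ1) column with clauses (iii) and (vi) on the class `𝒞₇`.**
[cite: SilvermanATAEC1994, Ch. II Thm. 9.2, Prop. 10.4 (proof) and Cor. 10.4.1 (a), Thm. 10.5 (b)] -/
theorem exists_grossencharacter_withGenerators_of_classCSeven {W : WeierstrassCurve ℚ} [W.IsElliptic]
    [W.IsGloballyMinimal] (hC : X12.ClassCSeven W) (Kcm : Type) [Field Kcm] [NumberField Kcm]
    (h2 : Module.finrank ℚ Kcm = 2) (s : Kcm) (hs : s ^ 2 = -7) :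
    ∃ (W₂ : WeierstrassCurve ℚ) (_ : W₂.IsElliptic) (_ : W₂.IsGloballyMinimal) (ψ : HeckeCharacter Kcm),
      IsIsogenous W W₂ ∧ W₂.j = -3375 ∧
      ψ.HasInfinityType (fun _ ↦ 1) (fun _ ↦ 0) ∧
      (∀ z : ℂ, 3 / 2 < z.re → heckeLFunction ψ z = W.LSeries z) ∧
      (∀ w : HeightOneSpectrum (𝓞 Kcm),
        ψ.IsUnramifiedAt w ↔ (W₂.baseChange Kcm).HasGoodReductionAt w) ∧
      ∃ σ : Kcm →+* ℂ, ∀ w : HeightOneSpectrum (𝓞 Kcm), ψ.IsUnramifiedAt w →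
        ∃ α : 𝓞 Kcm, Ideal.span {α} = w.asIdeal ∧ ψ.valueAtUniformizer w = σ α :=
  exists_grossencharacter_withGenerators hC.2.1 Kcm h2 s hs

end Summit.BirchSwinnertonDyer.Rank1Residual.Additive.GenusSeven.MemberGrossencharacter

end
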